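import Literature.Barriers.CriticalPhenomena.LaceExpansionXSpaceNorms
import Mathlib.Analysis.SpecificLimits.Normed
import HarnessLib

/-!
# Hara 2008, Lemma 1.5 (percolation): step (iv) of the printed proof — from the two-long-lines
# bound on the `N`-loop coefficients `Π^{(N)}_{p_c}` to `|Π(x)| ≤ cβ²⟦x⟧^{-2α}` (Hara 2008, §3.5)

Barrier catalogue `Literature/Barriers/CriticalPhenomena/` (D-0021), companion of
`LaceExpansionXSpaceNorms.lean`, whose named fact `Hara2008_lemma15Pc` is Hara's first
diagrammatic lemma for percolation at `p = p_c`, `d ≥ 11`: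
"`G(x) ≤ β⟦x⟧^{-α}` (`β > 0`, `0 < α < d`) gives `|Π(x)| ≤ cβ²⟦x⟧^{-2α}` for `x ≠ 0`".

Triage of its printed proof (Hara 2008, §3.5 with §3.1, §3.4, Prop. 1.2 and Appendix A): a
theory (XL). It rests on (i) the Hara–Slade lace expansion for percolation,
`Π_p = Σ_{N ≥ 0} (-1)^N Π^{(N)}_p` with `Π^{(N)}_p ≥ 0` bounded by the `2^N` `N`-loop diagrams
(Hara–Slade 1990; Heydenreich–van der Hofstad 2017, (7.4.10)), carried to `p = p_c`
(Appendix A); (ii) the `x`-space analysis of those diagrams — on each of the two disjoint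
`0`–`x` lines of an `N`-loop diagram (at most `2N+1` segments each) one segment is at least
`|x|/(2N+1)` long; extracting the two long lines gives two factors of
`G_{x,N} := sup_{|y| ≥ |x|/(2N+1)} G(y)`, and the rest is bounded by triangles, bubbles and — in
Case 2, which forces `d > 8` — squares `S̄^{(0)}` (finite by the infrared bound), "at least
`(N-3)` factors of `cλ` and two factors of `G_{x,N}` for each diagram", times the `O(N²)` choices
of long segments; (iii) the smallness of `λ` making the sum over `N` converge ("λ ≪ 1": in
Hara's text from `λ ≤ c₃/d`, complete "only for large `d` (say `d ≥ 30`)"; for `d ≥ 19` by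
estimates announced in Hara–Slade 1994; for `11 ≤ d ≤ 18` by the computer-assisted
verification of Fitzner–van der Hofstad 2017, Thm. 1.4 and §7: "by a recent improvement of the
bounds by Hara compared to [Hara08], it suffices to prove that `T_{p_c}(1 + 2T̄^{(0,0)}) < 1` …
which needs to be at most `1` as it appears to the power `N-1` … and is being summed out over
`N`", with `T̄^{(0,0)} ≤ 0.53562`, `T_{p_c} ≤ 0.28036` at `d = 11`); and (iv) the final summation:
`G_{x,N} ≤ β(2N+2)^α/|x|^α`, whence `|Π(x)| ≤ Σ_N Π^{(N)}(x) ≤ cβ²⟦x⟧^{-2α}`.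

Steps (i)–(iii) are the two named facts of the companion files, cut along the seam of their
sources: the PROBABILISTIC input `HvdH2017_piNDiagramBoundPc` (`LaceExpansionXSpaceLemma16.lean`:
the coefficients `Π^{(N)}_{p_c} ≥ 0`, `Π_{p_c} = Σ_N (-1)^N Π^{(N)}_{p_c}`, bounded by the explicit
diagrams `piNDiagramPc d N` of Heydenreich–van der Hofstad (7.2.9), (7.4.10); shared with
Lemma 1.6) and the ANALYTIC input `Hara2008_twoLongLinesDiagramBoundPc`
(`LaceExpansionXSpaceLemma15Diagrams.lean`: Hara's §3.5 two-long-lines estimate on those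
diagrams, `piNDiagramPc d N x ≤ C(N+1)² q^N G_{x,N}²` with `q < 1`, `d ≥ 11`).

Step (iv) is PROVED here, pointwise in the data: `abs_le_of_piTwoLongLines` — for any `Φ` with
`Φ = Σ_N (-1)^N Π^{(N)}`, `Π^{(N)} ≥ 0`, `Σ_N Π^{(N)}(x) < ∞` and
`Π^{(N)}(x) ≤ C(N+1)² q^N b²` (`x ≠ 0`, `0 ≤ q < 1`, every `b` dominating `G` on
`|y| ≥ |x|/(2N+1) - 1`), the hypothesis `G ≤ β⟦·⟧^{-α}` gives `|Φ(x)| ≤ cβ²⟦x⟧^{-2α}` with `c`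
independent of `β`. It uses nothing about `α` beyond `α > 0` (the polynomial
`(N+1)²(4N+2)^{2α}` is summable against `q^N`), in accordance with the printed proof, where the
hypothesis `G ≤ β⟦x⟧^{-α}` enters only through `G_{x,N}`. The assembly
`Hara2008_lemma15Pc_of_diagramBounds : HvdH2017_piNDiagramBoundPc →
Hara2008_twoLongLinesDiagramBoundPc → Hara2008_lemma15Pc` is in
`LaceExpansionXSpaceLemma15Diagrams.lean`.

On the threshold `|x|/(2N+1) - 1` instead of the printed `|x|/(2N+1)`: the percolation diagrams
contain lines `2dp(D ⋆ G)(y - x) = 2dp Σ_{|z-x|=1} (2d)^{-1} G(y - z)`, "almost the same as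
`G(y-x)` for large `|y-x|`" (Hara 2008, §3.4), whose `G`-factor is displaced by a unit vector
from the segment it represents; a long segment of this kind yields `G` at an argument of length
`≥ |x|/(2N+1) - 1`. Lowering the threshold by one makes the printed sentence exact and only
weakens the two-long-lines bound; in step (iv) it costs the constant `(4N+2)^α` in place of
`(2N+2)^α` (`⟦x⟧ ≤ (4N+2)⟦y⟧` for such `y`, `jnorm_le_of_far`).

## Contents (all proved; no named fact in this file)

* `jnorm_le_of_far`, `div_jnorm_rpow_le_of_far` (the bound `G_{x,N} ≤ β(4N+2)^α⟦x⟧^{-α}`),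
  `summable_pow_add_one_mul_geometric`, `sq_mul_pow_le` (polynomial bookkeeping: the number of
  choices of the long segments times their length factor against the geometric rate);
* `abs_le_of_piTwoLongLines` — step (iv).

## References

* T. Hara, Ann. Probab. 36 (2008) 530–593 (arXiv:math-ph/0504021): §1.2 ("only give a proof
  for large `d` (say `d ≥ 30`) for percolation. Results for percolation in `d ≥ 19` can be
  obtained by more detailed diagrammatic estimates which slightly improve conditions in
  Lemmas 1.5 and 1.6"); Prop. 1.2 (`Π_p = Σ_n (-1)^n Π^{(n)}_p` with `Π^{(n)}_p` nonnegative,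
  `0 ≤ Π^{(n)}_p ≤ h^{(n)}`, `Σ_xΣ_n h^{(n)} ≤ c/d`; `T̄^{(0,0)}_p < λ`, `λ ≤ c₃/d` for percolation in
  `d ≥ 19`); Lemma 1.5 (§1.2.3); §3.1 (the inequality `Σ_x f(x)g(x) ≤ [sup_x f(x)][Σ_x g(x)]`);
  §3.4 (the lines `2dp(D ⋆ G)`, "(2N+1) segments", "2^N diagrams for `Π^{(N)}`"); §3.5 (proof
  of Lemma 1.5 for percolation: the display defining
  `G_{x,N} := sup_{|y| ≥ |x|/(2N+1)} G(y) ≤ β(2N+2)^α/|x|^α`, Cases 1–2, "we can collect at least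
  `(N-3)` factors of `cλ` and two factors of `G_{x,N}` for each diagram. Multiplying by the
  number of different choices of long segments [which is `O(N²)`], and summing over `N` proves
  the lemma"); Appendix A (items 1–4, Lemma A.1: `p = p_c`).
* M. Heydenreich, R. van der Hofstad, *Progress in High-Dimensional Percolation and Random
  Graphs*, Springer 2017: (7.2.9), (7.4.1)–(7.4.4) and (7.4.10) (the diagrams bounding `Π^{(N)}`),
  Prop. 7.4.
* R. Fitzner, R. van der Hofstad, Electron. J. Probab. 22 (2017) no. 43 (arXiv:1506.07977):
  Thm. 1.4 ("The proof of Theorem 1.4 follows by verifying that the conditions that Hara poses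
  in [Hara08], which are formulated in terms of the classical lace expansion, are satisfied") and
  §7 (proof of Thm. 1.4: `T̄^{(0,0)} ≤ 0.53562`, `T_{p_c} ≤ 0.28036` at `d = 11`; "it suffices to
  prove that `T_{p_c}(1 + 2T̄^{(0,0)}) < 1` … as it appears to the power `N-1` … and is being summed
  out over `N`").
-/

noncomputable section

namespace Literature.Barriers.CriticalPhenomena

open _root_.Filter Literature.Probability.LatticeModels Literature.Probability.Percolation

variable {d : ℕ}

/-! ### Step (iv) of the printed proof: `G_{x,N} ≤ β(2N+2)^α/|x|^α` and the sum over `N` -/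

/-- A site at distance `≥ |x|/(2N+1) - 1` from the origin has `⟦x⟧ ≤ (4N+2)⟦y⟧`
(`|x| ≤ (2N+1)(|y|+1) ≤ (2N+1)·2⟦y⟧`). [folklore] -/
theorem jnorm_le_of_far {x y : Site d} {N : ℕ}
    (h : euclidNorm x / (2 * N + 1) - 1 ≤ euclidNorm y) :
    jnorm x ≤ (4 * N + 2) * jnorm y := by
  have hN0 : (0 : ℝ) ≤ N := Nat.cast_nonneg N
  have hN : (0 : ℝ) < 2 * N + 1 := by linarith
  have hy1 : 1 ≤ jnorm y := one_le_jnorm y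
  have hyE : euclidNorm y ≤ jnorm y := euclidNorm_le_jnorm y
  have h1 : euclidNorm x ≤ (euclidNorm y + 1) * (2 * N + 1) := (div_le_iff₀ hN).1 (by linarith)
  have h2 : (euclidNorm y + 1) * (2 * N + 1) ≤ 2 * jnorm y * (2 * N + 1) :=
    mul_le_mul_of_nonneg_right (by linarith) hN.le
  refine max_le (by linarith) ?_
  nlinarith

/-- **`G_{x,N} ≤ β(2N+2)^α/|x|^α` in the form used here**: under `G ≤ β⟦·⟧^{-α}` every `y` with
`|y| ≥ |x|/(2N+1) - 1` has `β/⟦y⟧^α ≤ β(4N+2)^α/⟦x⟧^α` (`α, β ≥ 0`).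
[cite: Hara2008, §3.5 (the display G_{x,N} ≤ β(2N+2)^α/|x|^α, "where the second inequality follows from our assumption of the lemma on G(x)")] -/
theorem div_jnorm_rpow_le_of_far {x y : Site d} {N : ℕ} {α β : ℝ} (hα : 0 ≤ α) (hβ : 0 ≤ β)
    (h : euclidNorm x / (2 * N + 1) - 1 ≤ euclidNorm y) :
    β / jnorm y ^ α ≤ β * (4 * N + 2) ^ α / jnorm x ^ α := by
  have hxy := jnorm_le_of_far h
  have hK : (0 : ℝ) ≤ 4 * N + 2 := by positivity
  have hypos : 0 < jnorm y ^ α := Real.rpow_pos_of_pos (jnorm_pos y) α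
  have hxpos : 0 < jnorm x ^ α := Real.rpow_pos_of_pos (jnorm_pos x) α
  rw [div_le_div_iff₀ hypos hxpos]
  have hpow : jnorm x ^ α ≤ (4 * N + 2) ^ α * jnorm y ^ α := by
    rw [← Real.mul_rpow hK (jnorm_pos y).le]
    exact Real.rpow_le_rpow (jnorm_pos x).le hxy hα
  calc β * jnorm x ^ α ≤ β * ((4 * N + 2) ^ α * jnorm y ^ α) := mul_le_mul_of_nonneg_left hpow hβ
    _ = β * (4 * N + 2) ^ α * jnorm y ^ α := by ring

/-- `Σ_N (N^m + 1) q^N < ∞` for `0 ≤ q < 1` (a polynomial against a geometric sequence).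
[folklore] -/
theorem summable_pow_add_one_mul_geometric {q : ℝ} (hq0 : 0 ≤ q) (hq1 : q < 1) (m : ℕ) :
    Summable fun N : ℕ => ((N : ℝ) ^ m + 1) * q ^ N := by
  have hq : ‖q‖ < 1 := by rwa [Real.norm_eq_abs, abs_of_nonneg hq0]
  have h1 : Summable fun N : ℕ => (N : ℝ) ^ m * q ^ N :=
    summable_pow_mul_geometric_of_norm_lt_one m hq
  have h2 : Summable fun N : ℕ => q ^ N := summable_geometric_of_lt_one hq0 hq1
  convert h1.add h2 using 1
  funext N
  ring

/-- The polynomial bookkeeping `(N+1)²(4N+2)^k ≤ 6^{k+2}(N^{k+2} + 1)` (number of choices of the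
long segments times their length factor, against a pure power). [folklore] -/
theorem sq_mul_pow_le (N k : ℕ) : (N + 1) ^ 2 * (4 * N + 2) ^ k ≤ 6 ^ (k + 2) * (N ^ (k + 2) + 1) := by
  have h1 : (N + 1) ^ 2 * (4 * N + 2) ^ k ≤ (4 * N + 2) ^ (k + 2) := by
    rw [pow_add, mul_comm]
    exact Nat.mul_le_mul_left _ (Nat.pow_le_pow_left (by omega) 2)
  refine h1.trans ?_
  rcases Nat.eq_zero_or_pos N with rfl | hN
  · have h0 : (0 : ℕ) ^ (k + 2) = 0 := zero_pow (by omega)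
    rw [h0, zero_add, mul_one, mul_zero, zero_add]
    exact Nat.pow_le_pow_left (by norm_num) _
  · calc (4 * N + 2) ^ (k + 2) ≤ (6 * N) ^ (k + 2) := Nat.pow_le_pow_left (by omega) _
      _ = 6 ^ (k + 2) * N ^ (k + 2) := by rw [mul_pow]
      _ ≤ 6 ^ (k + 2) * (N ^ (k + 2) + 1) := Nat.mul_le_mul_left _ (Nat.le_succ _)

/-- **Step (iv) of Hara's proof of Lemma 1.5 (percolation), pointwise in the data.** For a
function `Φ` on `ℤ^d` represented as `Φ = Σ_N (-1)^N Π^{(N)}` with `Π^{(N)} ≥ 0`, `Σ_N Π^{(N)}(x) < ∞`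
and the two-long-lines bound `Π^{(N)}(x) ≤ C(N+1)²q^N b²` (`x ≠ 0`, `0 ≤ q < 1`, every `b`
dominating `G = τ_{p_c}(0,·)` on `|y| ≥ |x|/(2N+1) - 1`), the hypothesis `G ≤ β⟦·⟧^{-α}` (`α > 0`)
gives `G_{x,N} ≤ β(4N+2)^α⟦x⟧^{-α}` and hence
`|Φ(x)| ≤ Σ_N Π^{(N)}(x) ≤ [C Σ_N (N+1)²(4N+2)^{2α} q^N] β²⟦x⟧^{-2α}`, the bracket being finite and
independent of `β` ("Multiplying by the number of different choices of long segments [which is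
`O(N²)`], and summing over `N` proves the lemma"). The data `Π^{(N)}, C, q` are hypotheses here;
at `p_c`, `d ≥ 11`, they are supplied from the Hara–Slade diagram bounds in
`LaceExpansionXSpaceLemma15Diagrams.lean`.
[cite: Hara2008, §3.5 (the display G_{x,N} ≤ β(2N+2)^α/|x|^α and the closing paragraph) and Lemma 1.5] -/
theorem abs_le_of_piTwoLongLines {Φ : Site d → ℝ} {Pn : ℕ → Site d → ℝ} {C q : ℝ}
    (hC : 0 ≤ C) (hq0 : 0 ≤ q) (hq1 : q < 1) (hPnn : ∀ N x, 0 ≤ Pn N x)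
    (hPsum : ∀ x, Summable fun N => Pn N x) (hΦeq : ∀ x, Φ x = ∑' N, (-1) ^ N * Pn N x)
    (hbound : ∀ (N : ℕ) (x : Site d) (b : ℝ), x ≠ 0 →
      (∀ y : Site d, euclidNorm x / (2 * N + 1) - 1 ≤ euclidNorm y →
        tau d (criticalProbI d) 0 y ≤ b) →
      Pn N x ≤ C * ((N : ℝ) + 1) ^ 2 * q ^ N * b ^ 2)
    {α : ℝ} (hα : 0 < α) :
    ∃ c : ℝ, ∀ β : ℝ, 0 < β →
      (∀ x : Site d, tau d (criticalProbI d) 0 x ≤ β / jnorm x ^ α) →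
        ∀ x : Site d, x ≠ 0 → |Φ x| ≤ c * β ^ 2 / jnorm x ^ (2 * α) := by
  -- the polynomial degree absorbing `(N+1)² (4N+2)^{2α}`, and the majorant `T`
  set k : ℕ := ⌈2 * α⌉₊ with hk
  set T : ℕ → ℝ := fun N => C * 6 ^ (k + 2) * (((N : ℝ) ^ (k + 2) + 1) * q ^ N) with hT
  have hTs : Summable T :=
    (summable_pow_add_one_mul_geometric hq0 hq1 (k + 2)).mul_left (C * 6 ^ (k + 2))
  refine ⟨∑' N, T N, fun β hβ hG x hx => ?_⟩
  have hJ := jnorm_pos x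
  -- `G_{x,N} ≤ β (4N+2)^α / ⟦x⟧^α`
  have hfar : ∀ (N : ℕ) (y : Site d), euclidNorm x / (2 * N + 1) - 1 ≤ euclidNorm y →
      tau d (criticalProbI d) 0 y ≤ β * (4 * N + 2) ^ α / jnorm x ^ α := fun N y hy =>
    (hG y).trans (div_jnorm_rpow_le_of_far hα.le hβ.le hy)
  have hpow2 : ∀ {u : ℝ}, 0 ≤ u → (u ^ α) ^ 2 = u ^ (2 * α) := fun hu => by
    rw [mul_comm, Real.rpow_mul hu, Real.rpow_two]
  -- the per-`N` bound `Π^{(N)}(x) ≤ T N · β²/⟦x⟧^{2α}`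
  have hkey : ∀ N, Pn N x ≤ T N * (β ^ 2 / jnorm x ^ (2 * α)) := by
    intro N
    have hN0 : (0 : ℝ) ≤ N := Nat.cast_nonneg N
    have hK0 : (0 : ℝ) ≤ 4 * N + 2 := by linarith
    have hK1 : (1 : ℝ) ≤ 4 * N + 2 := by linarith
    have h1 := hbound N x _ hx (hfar N)
    have hsq : (β * (4 * N + 2) ^ α / jnorm x ^ α) ^ 2 =
        (4 * (N : ℝ) + 2) ^ (2 * α) * (β ^ 2 / jnorm x ^ (2 * α)) := by
      rw [div_pow, mul_pow, hpow2 hK0, hpow2 hJ.le]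
      ring
    have hpoly : ((N : ℝ) + 1) ^ 2 * (4 * N + 2) ^ (2 * α) ≤
        6 ^ (k + 2) * ((N : ℝ) ^ (k + 2) + 1) := by
      have hceil : (4 * (N : ℝ) + 2) ^ (2 * α) ≤ (4 * N + 2) ^ k := by
        rw [← Real.rpow_natCast]
        exact Real.rpow_le_rpow_of_exponent_le hK1 (Nat.le_ceil _)
      have hnat' : ((N : ℝ) + 1) ^ 2 * (4 * N + 2) ^ k ≤ 6 ^ (k + 2) * ((N : ℝ) ^ (k + 2) + 1) := by
        exact_mod_cast sq_mul_pow_le N k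
      exact (mul_le_mul_of_nonneg_left hceil (by positivity)).trans hnat'
    calc Pn N x ≤ C * ((N : ℝ) + 1) ^ 2 * q ^ N * (β * (4 * N + 2) ^ α / jnorm x ^ α) ^ 2 := h1
      _ = C * q ^ N * (((N : ℝ) + 1) ^ 2 * (4 * N + 2) ^ (2 * α)) *
            (β ^ 2 / jnorm x ^ (2 * α)) := by
          rw [hsq]
          ring
      _ ≤ C * q ^ N * (6 ^ (k + 2) * ((N : ℝ) ^ (k + 2) + 1)) * (β ^ 2 / jnorm x ^ (2 * α)) :=
          mul_le_mul_of_nonneg_right (mul_le_mul_of_nonneg_left hpoly (by positivity))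
            (by positivity)
      _ = T N * (β ^ 2 / jnorm x ^ (2 * α)) := by
          simp only [hT]
          ring
  -- the sum over `N`
  have hnorm : ∀ N, ‖(-1 : ℝ) ^ N * Pn N x‖ = Pn N x := fun N => by
    rw [norm_mul, norm_pow, norm_neg, norm_one, one_pow, one_mul, Real.norm_eq_abs,
      abs_of_nonneg (hPnn N x)]
  have hns : Summable fun N => ‖(-1 : ℝ) ^ N * Pn N x‖ :=
    (hPsum x).congr fun N => (hnorm N).symm
  calc |Φ x| = ‖∑' N, (-1 : ℝ) ^ N * Pn N x‖ := by rw [hΦeq x, Real.norm_eq_abs]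
    _ ≤ ∑' N, ‖(-1 : ℝ) ^ N * Pn N x‖ := norm_tsum_le_tsum_norm hns
    _ = ∑' N, Pn N x := tsum_congr hnorm
    _ ≤ ∑' N, T N * (β ^ 2 / jnorm x ^ (2 * α)) :=
        (hPsum x).tsum_le_tsum hkey (hTs.mul_right _)
    _ = (∑' N, T N) * (β ^ 2 / jnorm x ^ (2 * α)) := tsum_mul_right
    _ = (∑' N, T N) * β ^ 2 / jnorm x ^ (2 * α) := by ring

end Literature.Barriers.CriticalPhenomena
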